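import Literature.Analysis.FluidPDE.NSBoundedMildOseenDuhamel
import Literature.Analysis.FluidPDE.KNSSRemark61
import Literature.Analysis.FluidPDE.SelfSimilar
import HarnessLib

/-!
# Type I ancient mild solutions in the Oseen (Koch–Nadirashvili–Seregin–Šverák) gauge

Topic `Literature/Analysis/FluidPDE`; definition request `defn-IsTypeIAncientMild` of route
`SymmetryModuliCount` (NavierStokesRegularity), which repeats the class below inline in every item.

Let `E` be a finite-dimensional real inner product space (`E = ℝ³` in the route). The class
`Literature.Analysis.FluidPDE.IsTypeIAncientMild C u` of a field `u : ℝ → E → E` on `(-∞, 0) × E`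
is the conjunction of

1. joint smoothness: `uncurry u` is `C^∞` on the open slab `(-∞, 0) × E`;
2. `div u(t) = 0` pointwise for every `t < 0` (`VectorCalculus.IsDivFree`);
3. the **Oseen-kernel integral equation between every pair of times** `s < t < 0`:
   `u(t) = e^{(t-s)Δ} u(s) - B¹_s(u,u)(t)`, i.e. with the tree's objects
   `u t x = heatFlow (u s) (t - s) x - oseenDuhamel 1 s u u t x`
   (`oseenDuhamel 1 s u u t x = ∫_{τ ∈ (s,t)} ∫ K(t-τ, x-y)[u(τ,y), u(τ,y)] dy dτ`, `K = oseenKernel` the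
   kernel of `e^{σΔ} P ∇·`; Koch–Nadirashvili–Seregin–Šverák 2009, §4 p. 8: "`u = U + B(u,u)`", with
   §3 p. 6 (the representation formula defining mild solutions) and §6 p. 11 (ancient mild
   solutions: mild "in `ℝⁿ × (T_l, 0)` with initial datum `u(·, T_l)`" along `T_l → -∞`);
   Seregin–Šverák 2009, §1, formula (1.1) "`u(t) = S(t-t₀)u(t₀) + ∫_{t₀}^t S(t-s)P div(u ⊗ u) ds`";
   Seregin 2014, Def. 6.3 p. 109 gives the equivalent pressure formulation `p ∈ L_∞(BMO)`).
   This is the gauge that removes the "parasitic solutions" `u(x,t) = b(t)`, `p = -b'(t)·x`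
   (KNSS 2009, §1 p. 3; Seregin 2014, p. 113: `c(t)` is a mild bounded ancient solution iff
   `c ≡ const`) and the time-dependent Galilean frames;
4. the **Type I temporal bound** `‖u(t,x)‖ ≤ C / √(-t)` (`HasTypeITimeDecay C u`; KNSS 2009 (1.4),
   Seregin–Šverák 2009 (1.3)).

Design notes.
* Versus the printed notion (KNSS §6: the representation formula from a *sequence* `T_l → -∞`;
  Seregin–Šverák (1.1): "for some sequence of times `t₀ → -∞`") we require the formula between
  **all** pairs `s < t < 0`, verbatim as the route states it; for bounded mild solutions the two
  agree by the restart (semigroup) property of the Oseen equation (KNSS §4 p. 8, "`u = U + B(u,u)`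
  … as an ODE in `t`"; the tree's named fact `oseenMild_restart`).
* A Type I ancient field is bounded on every `(-∞, -δ)`, `δ > 0`, but not on `(-∞, 0)`; so it is
  not literally a "bounded ancient mild solution". The bridge to the tree's duality-form class
  (`SelfSimilar.lean`) is proved here: `IsTypeIAncientMild C u → IsAncientMildSolution 1 u`
  (`IsTypeIAncientMild.isAncientMildSolution`: weakly divergence-free slices, and the two-time
  duality identity `IsMildNSSolutionBetween 1 0 u s t` for all `s < t < 0`, from the tested
  identities of the Oseen Duhamel term and of the caloric extension of bounded fields,
  `NSBoundedMildOseenDuhamel.lean`), and after a time shift `δ > 0` the field is a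
  **bounded** ancient mild solution (`IsTypeIAncientMild.isBoundedAncientMildSolution_sub`).
* `isTypeIAncientMild_iff` unfolds the class to the literal form used by the route
  (`∫ τ in Ioo s t, ∫ y, oseenKernel (t - τ) (x - y) (u τ y) (u τ y)`, unit viscosity).
* Smoothness (1) is part of the class as requested; for bounded mild solutions it is a theorem
  (KNSS 2009, Prop. 4.1; Seregin 2014, Prop. 3.9), recorded in the tree as the named fact
  `knss2009_smoothing` and not re-proved here.

## References

* G. Koch, N. Nadirashvili, G. Seregin, V. Šverák, *Liouville theorems for the Navier–Stokes
  equations and applications*, Acta Math. 203 (2009) 83–105 = arXiv:0709.3599 (arXiv pagination):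
  §1 p. 3, §3 p. 6, §4 p. 8, §6 p. 11 (Lemma 6.1, Remark 6.1). [KochNadirashviliSereginSverak2009]
* G. Seregin, V. Šverák, *On Type I singularities of the local axi-symmetric solutions of the
  Navier–Stokes equations*, Comm. PDE 34 (2009) = arXiv:0804.1803, §1 (1.1), Conjecture (L),
  Def. 2.3. [SereginSverak2009]
* G. Seregin, *Lecture Notes on Regularity Theory for the Navier–Stokes Equations*, World
  Scientific 2014, §6.3, Def. 6.3 (p. 109), Prop. 3.9, p. 113 (PDF pagination). [Seregin2014Notes]
-/

noncomputable section

open MeasureTheory Set Function Filter TopologicalSpace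
open _root_.Topology
open scoped RealInnerProductSpace NNReal ENNReal

namespace Literature.Analysis.FluidPDE

variable {E : Type*} [NormedAddCommGroup E] [InnerProductSpace ℝ E] [FiniteDimensional ℝ E]
  [MeasurableSpace E] [BorelSpace E]

/-! ### The class -/

/-- **Type I ancient mild solutions in the Oseen (KNSS) gauge** with constant `C`: fields
`u : ℝ → E → E` on `(-∞, 0) × E` which are jointly `C^∞` on the open slab `(-∞,0) × E`, have
divergence-free slices `u t` (`t < 0`), satisfy the Oseen-kernel integral equation
`u(t) = e^{(t-s)Δ}u(s) - B¹_s(u,u)(t)`, i.e. `u t x = heatFlow (u s) (t - s) x - oseenDuhamel 1 s u u t x`,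
between **every** pair of times `s < t < 0` (Koch–Nadirashvili–Seregin–Šverák 2009, §4 p. 8,
`u = U + B(u,u)`, with §6 p. 11 (ancient mild solutions); Seregin–Šverák 2009, (1.1); the gauge
excluding the parasitic solutions `u = b(t)`, KNSS §1 p. 3, Seregin 2014 Def. 6.3 p. 109 and
p. 113), and obey the Type I temporal bound `‖u(t,x)‖ ≤ C/√(-t)` (`HasTypeITimeDecay C u`).
Unit viscosity. [cite: KochNadirashviliSereginSverak2009, §4 p. 8 and §6 p. 11 (arXiv:0709.3599); Type I bound (1.4)] -/
def IsTypeIAncientMild (C : ℝ) (u : ℝ → E → E) : Prop :=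
  ContDiffOn ℝ (⊤ : ℕ∞) (uncurry u) (Iio 0 ×ˢ univ) ∧
    (∀ t < 0, VectorCalculus.IsDivFree (u t)) ∧
    (∀ s t : ℝ, s < t → t < 0 → ∀ x, u t x = heatFlow (u s) (t - s) x - oseenDuhamel 1 s u u t x) ∧
    HasTypeITimeDecay C u

/-- Unfolding `IsTypeIAncientMild` to the literal form used by route `SymmetryModuliCount`: the
Duhamel term written out with the Oseen kernel at unit viscosity,
`∫_{τ ∈ (s,t)} ∫ K(t-τ, x-y)[u(τ,y), u(τ,y)] dy dτ` (KNSS 2009, §4 p. 8, `B(u,v)`). [cite: KochNadirashviliSereginSverak2009, §4 p. 8 (arXiv:0709.3599)] -/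
theorem isTypeIAncientMild_iff {C : ℝ} {u : ℝ → E → E} :
    IsTypeIAncientMild C u ↔
      ContDiffOn ℝ (⊤ : ℕ∞) (uncurry u) (Iio 0 ×ˢ univ) ∧
        (∀ t < 0, VectorCalculus.IsDivFree (u t)) ∧
        (∀ s t : ℝ, s < t → t < 0 → ∀ x, u t x = heatFlow (u s) (t - s) x -
          ∫ τ in Ioo s t, ∫ y, oseenKernel (t - τ) (x - y) (u τ y) (u τ y)) ∧
        HasTypeITimeDecay C u := by
  simp only [IsTypeIAncientMild, oseenDuhamel, one_mul]

/-- **The trivial solution** `u ≡ 0` is a Type I ancient mild field for every constant `C ≥ 0`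
(`e^{σΔ}0 = 0`, `B(0,0) = 0`); by the Liouville statement (L') of the route it should be the only
one. Non-vacuity of the class. [folklore] -/
theorem isTypeIAncientMild_zero {C : ℝ} (hC : 0 ≤ C) : IsTypeIAncientMild C (0 : ℝ → E → E) := by
  haveI : CompleteSpace E := FiniteDimensional.complete ℝ E
  refine ⟨contDiffOn_const, fun t _ x => by simp [VectorCalculus.divergence],
    fun s t hst _ x => ?_, fun t _ x => ?_⟩
  · have e0 : ((0 : ℝ → E → E) s) = fun _ => (0 : E) := rfl
    rw [oseenDuhamel_zero_left, heatFlow_of_pos _ (sub_pos.2 hst), e0,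
      UnboundedOperators.heatExtension_const _ (sub_pos.2 hst)]
    simp
  · simp only [Pi.zero_apply, norm_zero]
    positivity

/-- **Time-translation covariance of the Duhamel term**: translating both fields in time by `δ`
translates `B^ν_s(u,v)(t)` — `B^ν_s(u(· - δ), v(· - δ))(t) = B^ν_{s-δ}(u, v)(t - δ)` (the substitution
`τ ↦ τ - δ` in the outer time integral; the equation is autonomous; KNSS 2009, §4 p. 8). [cite: KochNadirashviliSereginSverak2009, §4 p. 8 (arXiv:0709.3599)] -/
theorem oseenDuhamel_comp_sub_right (ν s t δ : ℝ) (u v : ℝ → E → E) (x : E) :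
    oseenDuhamel ν s (fun τ => u (τ - δ)) (fun τ => v (τ - δ)) t x =
      oseenDuhamel ν (s - δ) u v (t - δ) x := by
  simp only [oseenDuhamel]
  set g : ℝ → E := fun σ => ∫ y, oseenKernel (ν * (t - δ - σ)) (x - y) (u σ y) (v σ y) with hg
  have e : (fun τ => ∫ y, oseenKernel (ν * (t - τ)) (x - y) (u (τ - δ) y) (v (τ - δ) y)) =
      fun τ => g (τ - δ) := by
    funext τ
    simp only [hg, sub_sub_sub_cancel_right]
  rw [e]
  rcases le_or_gt s t with hst | hts
  · rw [← integral_Ioc_eq_integral_Ioo, ← intervalIntegral.integral_of_le hst,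
      intervalIntegral.integral_comp_sub_right g δ,
      intervalIntegral.integral_of_le (sub_le_sub_right hst δ), integral_Ioc_eq_integral_Ioo]
  · rw [Ioo_eq_empty (not_lt.2 hts.le), Ioo_eq_empty (not_lt.2 (sub_le_sub_right hts.le δ)),
      Measure.restrict_empty, integral_zero_measure, integral_zero_measure]

/-! ### Two integrability helpers -/

/-- Pairing a continuous field with a continuous compactly supported one is integrable. [folklore] -/
theorem integrable_inner_of_continuous_of_hasCompactSupport {v φ : E → E} (hv : Continuous v)
    (hφ : Continuous φ) (hφc : HasCompactSupport φ) :
    Integrable (fun x => ⟪v x, φ x⟫) (volume : Measure E) := by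
  refine (hv.inner hφ).integrable_of_hasCompactSupport ?_
  refine HasCompactSupport.of_support_subset_isCompact hφc fun x hx => ?_
  refine subset_tsupport φ (mem_support.2 fun hφx => ?_)
  exact (mem_support.1 hx) (by rw [hφx, inner_zero_right])

/-- Pairing a bounded a.e. strongly measurable field with a continuous compactly supported one is
integrable (`|⟪B, φ⟫| ≤ K ‖φ‖`). [folklore] -/
theorem integrable_inner_of_norm_le_of_hasCompactSupport {B φ : E → E}
    (hB : AEStronglyMeasurable B (volume : Measure E)) {K : ℝ} (hK : ∀ x, ‖B x‖ ≤ K)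
    (hφ : Continuous φ) (hφc : HasCompactSupport φ) :
    Integrable (fun x => ⟪B x, φ x⟫) (volume : Measure E) := by
  refine Integrable.mono' (((hφ.norm).integrable_of_hasCompactSupport hφc.norm).const_mul K)
    (hB.inner hφ.aestronglyMeasurable) (Eventually.of_forall fun x => ?_)
  calc ‖⟪B x, φ x⟫‖ ≤ ‖B x‖ * ‖φ x‖ := norm_inner_le_norm _ _
    _ ≤ K * ‖φ x‖ := mul_le_mul_of_nonneg_right (hK x) (norm_nonneg _)

namespace IsTypeIAncientMild

variable {C : ℝ} {u : ℝ → E → E}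

/-- Joint smoothness on the open slab `(-∞, 0) × E` (projection; KNSS 2009, Prop. 4.1 is the
theorem behind it for bounded mild solutions). [cite: KochNadirashviliSereginSverak2009, Prop. 4.1 (arXiv:0709.3599 p. 8)] -/
theorem contDiffOn (h : IsTypeIAncientMild C u) :
    ContDiffOn ℝ (⊤ : ℕ∞) (uncurry u) (Iio 0 ×ˢ univ) :=
  h.1

/-- Divergence-free slices, `div u(t) = 0` for `t < 0` (projection). [cite: KochNadirashviliSereginSverak2009, §4 p. 8 (arXiv:0709.3599)] -/
theorem isDivFree (h : IsTypeIAncientMild C u) {t : ℝ} (ht : t < 0) :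
    VectorCalculus.IsDivFree (u t) :=
  h.2.1 t ht

/-- The Oseen integral equation between `s < t < 0`:
`u t x = e^{(t-s)Δ}u(s)(x) - B¹_s(u,u)(t)(x)` (projection; KNSS 2009, §4 p. 8). [cite: KochNadirashviliSereginSverak2009, §4 p. 8 (arXiv:0709.3599)] -/
theorem mild_eq (h : IsTypeIAncientMild C u) {s t : ℝ} (hst : s < t) (ht : t < 0) (x : E) :
    u t x = heatFlow (u s) (t - s) x - oseenDuhamel 1 s u u t x :=
  h.2.2.1 s t hst ht x

/-- The Oseen integral equation with the heat flow realised as the caloric extension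
`heatExtension (u s) (t - s)` (`t - s > 0`) (KNSS 2009, §4 p. 8, `U` = heat extension). [cite: KochNadirashviliSereginSverak2009, §4 p. 8 (arXiv:0709.3599)] -/
theorem mild_eq_heatExtension (h : IsTypeIAncientMild C u) {s t : ℝ} (hst : s < t) (ht : t < 0)
    (x : E) :
    u t x = UnboundedOperators.heatExtension (u s) (t - s) x - oseenDuhamel 1 s u u t x := by
  rw [h.mild_eq hst ht x, heatFlow_of_pos _ (sub_pos.2 hst)]

/-- The Oseen integral equation in the literal kernel form of the route
(`∫_{(s,t)} ∫ K(t-τ, x-y)[u, u]`; KNSS 2009, §4 p. 8). [cite: KochNadirashviliSereginSverak2009, §4 p. 8 (arXiv:0709.3599)] -/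
theorem mild_eq_oseenKernel (h : IsTypeIAncientMild C u) {s t : ℝ} (hst : s < t) (ht : t < 0)
    (x : E) :
    u t x = heatFlow (u s) (t - s) x -
      ∫ τ in Ioo s t, ∫ y, oseenKernel (t - τ) (x - y) (u τ y) (u τ y) := by
  simpa only [oseenDuhamel, one_mul] using h.mild_eq hst ht x

/-- The Type I temporal bound `‖u(t,x)‖ ≤ C/√(-t)` (projection; KNSS 2009, (1.4)). [cite: KochNadirashviliSereginSverak2009, (1.4)] -/
theorem hasTypeITimeDecay (h : IsTypeIAncientMild C u) : HasTypeITimeDecay C u :=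
  h.2.2.2

/-- The Type I bound at a point (KNSS 2009, (1.4)). [cite: KochNadirashviliSereginSverak2009, (1.4)] -/
theorem norm_le (h : IsTypeIAncientMild C u) {t : ℝ} (ht : t < 0) (x : E) :
    ‖u t x‖ ≤ C / Real.sqrt (-t) :=
  h.2.2.2 t ht x

/-- The Type I constant of an inhabited class is nonnegative: `0 ≤ ‖u(-1, 0)‖ ≤ C/√1 = C`. [folklore] -/
theorem nonneg (h : IsTypeIAncientMild C u) : 0 ≤ C := by
  have h1 := h.norm_le (t := -1) (by norm_num) 0
  rw [neg_neg, Real.sqrt_one, div_one] at h1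
  exact (norm_nonneg _).trans h1

/-- Uniform bound on a slab away from `t = 0`: for `τ ∈ (s, t)`, `t < 0`,
`‖u(τ, y)‖ ≤ C/√(-t)` (monotonicity of `C/√(-τ)`). [folklore] -/
theorem norm_le_of_mem_Ioo (h : IsTypeIAncientMild C u) {s t : ℝ} (ht : t < 0) {τ : ℝ}
    (hτ : τ ∈ Ioo s t) (y : E) : ‖u τ y‖ ≤ C / Real.sqrt (-t) := by
  refine (h.norm_le (hτ.2.trans ht) y).trans ?_
  exact div_le_div_of_nonneg_left h.nonneg (Real.sqrt_pos.2 (by linarith))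
    (Real.sqrt_le_sqrt (by linarith [hτ.2]))

/-- Every slice `u t`, `t < 0`, is `C^∞` (restrict the jointly smooth `uncurry u` along
`x ↦ (t, x)`). [folklore] -/
theorem contDiff_slice (h : IsTypeIAncientMild C u) {t : ℝ} (ht : t < 0) :
    ContDiff ℝ (⊤ : ℕ∞) (u t) :=
  h.1.comp_contDiff (contDiff_prodMk_right t) fun x => mk_mem_prod (mem_Iio.2 ht) (mem_univ x)

/-- Every slice `u t`, `t < 0`, is continuous. [folklore] -/
theorem continuous_slice (h : IsTypeIAncientMild C u) {t : ℝ} (ht : t < 0) : Continuous (u t) :=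
  (h.contDiff_slice ht).continuous

/-- Every slice `u t`, `t < 0`, is a.e. strongly measurable (it is continuous). [folklore] -/
theorem aestronglyMeasurable_slice (h : IsTypeIAncientMild C u) {t : ℝ} (ht : t < 0) :
    AEStronglyMeasurable (u t) (volume : Measure E) :=
  (h.continuous_slice ht).aestronglyMeasurable

/-- `uncurry u` is continuous on the open slab `(-∞, 0) × E`. [folklore] -/
theorem continuousOn_uncurry (h : IsTypeIAncientMild C u) :
    ContinuousOn (uncurry u) (Iio 0 ×ˢ univ) :=
  h.1.continuousOn

/-- Joint a.e. strong measurability of `u` on every slab `(s, T) × E`, `T ≤ 0` (continuity on the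
open slab), in the form consumed by the Oseen–Duhamel lemmas of `NSBoundedMildOseenDuhamel.lean`. [folklore] -/
theorem aestronglyMeasurable_uncurry (h : IsTypeIAncientMild C u) {s T : ℝ} (hT : T ≤ 0) :
    AEStronglyMeasurable (uncurry u)
      ((volume : Measure (ℝ × E)).restrict (Ioo s T ×ˢ univ)) :=
  (h.continuousOn_uncurry.mono
    (prod_mono (fun _ hτ => lt_of_lt_of_le hτ.2 hT) subset_rfl)).aestronglyMeasurable
    (measurableSet_Ioo.prod MeasurableSet.univ)

/-- Slices of a Type I ancient mild field are **weakly** divergence free (`∫ ⟪u(t), ∇θ⟫ = 0` for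
test `θ`): a `C¹` divergence-free field is weakly divergence free (Gauss–Green; the tree's
`VectorCalculus.IsDivFree.isWeaklyDivFree_holds`). [folklore] -/
theorem isWeaklyDivFree (h : IsTypeIAncientMild C u) {t : ℝ} (ht : t < 0) :
    IsWeaklyDivFree (u t) :=
  VectorCalculus.IsDivFree.isWeaklyDivFree_holds (h.isDivFree ht)
    ((h.contDiff_slice ht).of_le (by exact_mod_cast le_top))

/-! ### Bridge to the duality-form (very weak) class of `SelfSimilar.lean` -/

/-- **A Type I ancient mild field in the Oseen gauge satisfies the two-time duality identity**
`IsMildNSSolutionBetween 1 0 u s t` for all `s < t < 0` (Oseen integral form ⇒ very weak form;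
Lemarié-Rieusset 2016, Thm. 6.1, (6.12) ⇒ (6.11); KNSS 2009, Rem. 4.1: mild ⇒ weak). Test
`u(t) = e^{(t-s)Δ}u(s) - B¹_s(u,u)(t)` against a solenoidal test field `φ`: the caloric term gives
`∫⟪u(s), e^{(t-s)Δ}φ⟫` (symmetry of the heat pairing for the bounded slice `u(s)`,
`integral_inner_heatExtension_comm_of_bound`), the Duhamel term gives
`∫ₛᵗ∫⟪u(τ), (u(τ)·∇)e^{(t-τ)Δ}φ⟫` (`integral_inner_oseenDuhamel_eq_neg_intervalIntegral`, `u` being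
bounded by `C/√(-t)` and jointly measurable on `(s,t) × E`), and the force term vanishes. [cite: LemarieRieusset2016, Thm. 6.1 ((6.12) ⇒ (6.11))] -/
theorem isMildNSSolutionBetween (h : IsTypeIAncientMild C u) {s t : ℝ} (hst : s < t) (ht : t < 0) :
    IsMildNSSolutionBetween 1 0 u s t := by
  intro φ hφ hdiv
  have hs : s < 0 := hst.trans ht
  have hM : 0 ≤ C / Real.sqrt (-t) := div_nonneg h.nonneg (Real.sqrt_nonneg _)
  have huM : ∀ τ ∈ Ioo s t, ∀ y, ‖u τ y‖ ≤ C / Real.sqrt (-t) :=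
    fun τ hτ y => h.norm_le_of_mem_Ioo ht hτ y
  have hmeas := h.aestronglyMeasurable_uncurry (s := s) ht.le
  have hφc : Continuous φ := hφ.contDiff.continuous
  -- the three tested identities
  have hB := integral_inner_oseenDuhamel_eq_neg_intervalIntegral one_pos hmeas hM huM hst le_rfl
    hφ hdiv
  have hA := integral_inner_heatExtension_comm_of_bound (h.aestronglyMeasurable_slice hs)
    (fun x => h.norm_le hs x) hφc hφ.hasCompactSupport (sub_pos.2 hst)
  have hut : ∀ x, u t x =
      UnboundedOperators.heatExtension (u s) (t - s) x - oseenDuhamel 1 s u u t x :=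
    fun x => h.mild_eq_heatExtension hst ht x
  -- integrability of the three pairings
  obtain ⟨K, -, hK⟩ := exists_norm_oseenDuhamel_bounded_le (E := E)
  have hiB : Integrable (fun x => ⟪oseenDuhamel 1 s u u t x, φ x⟫) (volume : Measure E) :=
    integrable_inner_of_norm_le_of_hasCompactSupport
      (aestronglyMeasurable_oseenDuhamel one_pos hmeas hmeas hM huM huM hst le_rfl)
      (fun x => hK one_pos hst hM huM huM x) hφc hφ.hasCompactSupport
  have hiU : Integrable (fun x => ⟪u t x, φ x⟫) (volume : Measure E) :=
    integrable_inner_of_continuous_of_hasCompactSupport (h.continuous_slice ht) hφc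
      hφ.hasCompactSupport
  have hiA : Integrable
      (fun x => ⟪UnboundedOperators.heatExtension (u s) (t - s) x, φ x⟫) (volume : Measure E) := by
    refine (hiU.add hiB).congr (Eventually.of_forall fun x => ?_)
    simp only [Pi.add_apply, hut x, inner_sub_left, sub_add_cancel]
  -- assemble
  calc ∫ x, ⟪u t x, φ x⟫
      = ∫ x, (⟪UnboundedOperators.heatExtension (u s) (t - s) x, φ x⟫ -
          ⟪oseenDuhamel 1 s u u t x, φ x⟫) := by
        refine integral_congr_ae (Eventually.of_forall fun x => ?_)
        simp only [hut x, inner_sub_left]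
    _ = (∫ x, ⟪UnboundedOperators.heatExtension (u s) (t - s) x, φ x⟫) -
          ∫ x, ⟪oseenDuhamel 1 s u u t x, φ x⟫ := integral_sub hiA hiB
    _ = (∫ x, ⟪u s x, heatTest 1 φ (t - s) x⟫) +
          (∫ τ in s..t, ∫ x, ⟪u τ x, convect (u τ) (heatTest 1 φ (t - τ)) x⟫) +
          ∫ τ in s..t, ∫ x, ⟪(0 : ℝ → E → E) τ x, heatTest 1 φ (t - τ) x⟫ := by
        rw [hA, hB, heatTest_of_pos one_pos (sub_pos.2 hst), one_mul]
        simp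

/-- **Type I ancient mild fields are ancient mild solutions in the duality sense** of
`SelfSimilar.lean` (`IsAncientMildSolution 1 u`: weakly divergence-free slices and the two-time
duality identity between all `s < t < 0`; KNSS 2009, §6 p. 11, Rem. 4.1). [cite: KochNadirashviliSereginSverak2009, §6 p. 11 with Rem. 4.1 (arXiv:0709.3599)] -/
theorem isAncientMildSolution (h : IsTypeIAncientMild C u) : IsAncientMildSolution 1 u :=
  ⟨fun _ ht => h.isWeaklyDivFree ht, fun _ _ hst ht => h.isMildNSSolutionBetween hst ht⟩

/-- A Type I ancient mild field is bounded on every `(-∞, -δ)`, `δ > 0`, by `C/√δ`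
(`HasTypeITimeDecay.isBoundedOn`). [folklore] -/
theorem isBoundedOn (h : IsTypeIAncientMild C u) {δ : ℝ} (hδ : 0 < δ) : IsBoundedOn (Iio (-δ)) u :=
  h.hasTypeITimeDecay.isBoundedOn h.nonneg hδ

/-- **Bridge to the bounded class**: after a time shift by `δ > 0`, a Type I ancient mild field is
a **bounded ancient mild solution** in the sense of `SelfSimilar.lean`
(`IsBoundedAncientMildSolution 1 (fun t => u (t - δ))`; KNSS 2009, §1 and §6: the objects of the
Liouville conjecture (L)), with bound `C/√δ`. [cite: KochNadirashviliSereginSverak2009, §6 p. 11 (arXiv:0709.3599)] -/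
theorem isBoundedAncientMildSolution_sub (h : IsTypeIAncientMild C u) {δ : ℝ} (hδ : 0 < δ) :
    IsBoundedAncientMildSolution 1 (fun t => u (t - δ)) := by
  refine ⟨?_, ?_⟩
  · simpa only [sub_eq_add_neg] using h.isAncientMildSolution.time_translate (s := -δ) (by linarith)
  · obtain ⟨K, hK⟩ := h.isBoundedOn hδ
    exact ⟨K, fun t ht x => hK (t - δ) (by simp only [mem_Iio] at ht ⊢; linarith) x⟩

/-! ### Time translations and the exclusion of parasitic (slice-constant) elements -/

/-- **The class is invariant under time translations into the past**: for `0 ≤ δ`,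
`t ↦ u(t - δ)` is again a Type I ancient mild field with the same constant (the Oseen equation is
autonomous, `oseenDuhamel_comp_sub_right`, and `C/√(δ - t) ≤ C/√(-t)`; KNSS 2009, §1: the
symmetries of the problem). [cite: KochNadirashviliSereginSverak2009, §1 p. 3 (arXiv:0709.3599)] -/
theorem comp_sub_right (h : IsTypeIAncientMild C u) {δ : ℝ} (hδ : 0 ≤ δ) :
    IsTypeIAncientMild C (fun t => u (t - δ)) := by
  refine ⟨?_, fun t ht => h.isDivFree (by linarith), fun s t hst ht x => ?_, fun t ht x => ?_⟩
  · have e : (uncurry fun t x => u (t - δ) x) = uncurry u ∘ fun p : ℝ × E => (p.1 - δ, p.2) := rfl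
    rw [e]
    refine h.1.comp (((contDiff_fst.sub contDiff_const).prodMk contDiff_snd).contDiffOn) ?_
    intro p hp
    rw [mem_prod, mem_Iio] at hp ⊢
    exact ⟨by linarith [hp.1], mem_univ _⟩
  · have key := h.mild_eq (s := s - δ) (t := t - δ) (by linarith) (by linarith) x
    rw [oseenDuhamel_comp_sub_right, sub_sub_sub_cancel_right] at *
    exact key
  · refine (h.norm_le (by linarith) x).trans ?_
    exact div_le_div_of_nonneg_left h.nonneg (Real.sqrt_pos.2 (by linarith))
      (Real.sqrt_le_sqrt (by linarith))

/-- **Slice-constant elements are time-independent** (KNSS 2009, Remark 6.1, in the tree's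
rendering `KNSS2009_remark61`): if `u(t, ·) = b(t)` for all `t < 0` then `b(s) = b(t)` for all
`s, t < 0` — the heat flow fixes constants and the Duhamel term of constant fields vanishes
(the Oseen kernel has zero mean). [cite: KochNadirashviliSereginSverak2009, Remark 6.1 (arXiv p. 11)] -/
theorem const_eq_const_of_slice_const (h : IsTypeIAncientMild C u) {b : ℝ → E}
    (hub : ∀ t < 0, ∀ x, u t x = b t) {s t : ℝ} (hs : s < 0) (ht : t < 0) : b s = b t :=
  KNSS2009_remark61 one_pos hub (fun s' t' hst' ht' => Eventually.of_forall fun x => by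
    rw [one_mul]; exact h.mild_eq_heatExtension hst' ht' x) s t hs ht

/-- **The gauge kills the parasitic solutions**: a Type I ancient mild field which is spatially
constant on every slice, `u(t, ·) = b(t)`, vanishes identically — `b` is constant in time
(`const_eq_const_of_slice_const`) and `‖b‖ ≤ C/√(-s) → 0` as `s → -∞` (KNSS 2009, §1 p. 3 and
Remark 6.1; Seregin 2014, p. 113: "`c(t)` … is going to be a mild bounded ancient solution if and
only if `c(t) ≡ constant`"; Albritton–Barker 2019, §1: "`v ≡ const.` and `𝐈 < ∞` imply `v ≡ 0`"). [cite: KochNadirashviliSereginSverak2009, §1 p. 3 and Remark 6.1 (arXiv:0709.3599)] -/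
theorem eq_zero_of_slice_const (h : IsTypeIAncientMild C u) {b : ℝ → E}
    (hub : ∀ t < 0, ∀ x, u t x = b t) {t : ℝ} (ht : t < 0) (x : E) : u t x = 0 := by
  rw [hub t ht x]
  by_contra hb
  have hC : 0 ≤ C := h.nonneg
  have hb0 : 0 < ‖b t‖ := norm_pos_iff.2 hb
  set R : ℝ := C / ‖b t‖ + 1 with hR
  have hR0 : 0 < R := by positivity
  have hs : -(R ^ 2) < 0 := neg_neg_of_pos (pow_pos hR0 2)
  have key := h.norm_le hs (0 : E)
  rw [hub _ hs, h.const_eq_const_of_slice_const hub hs ht, neg_neg, Real.sqrt_sq hR0.le] at key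
  have key' : ‖b t‖ * R ≤ C := (le_div_iff₀ hR0).1 key
  have e : ‖b t‖ * R = C + ‖b t‖ := by
    rw [hR, mul_add, mul_one, mul_div_cancel₀ _ hb0.ne']
  linarith

end IsTypeIAncientMild

end Literature.Analysis.FluidPDE
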